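import Summits.KontsevichZagierPeriods.KontsevichZagierPeriods.Theorems.TerasomaMultiplicationDasGapTwelveStubInvolutionFold

/-!
# `DasGapTwelve` (stmt-KontsevichZagierPeriods-13215), line `picard-involution-quotient`,
stub `stub_involutionQuotient` — real algebra and analysis of the quotient map

The quotient of the Picard curve `v⁴ = t − t⁴` by its real involution
`τ₋ : (t, v) ↦ ((1−t)/(1+2t), −√3 v/(1+2t))` is the elliptic curve `V² = x³ − D x`, `D = 3 + 2√3`;
on the real arc `0 < t < 1` the quotient map is `x = 𝐰(t) = √((1 + t + t²)/(t(1 − t)))`, which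
folds each cell `(0, t⋆)`, `(t⋆, 1)`, `t⋆ = (√3 − 1)/2`, bijectively onto `(√D, ∞)`. With every
expression written out explicitly (no definitions; the style of
`HermiteRigidityGenusTwoCycleTransferPencil.lean`) this file supplies: the algebra of `t⋆`, of
`W = 2t² + 2t − 1 = 2(t − t⋆)(t + (1+√3)/2)` (numerator of `(N/Dn)′`, `N = 1 + t + t²`,
`Dn = t(1−t)`) and of `N − D·Dn = (1+√3)²(t − t⋆)²`; `𝐰 > √D` off `t⋆`; the fibres of `𝐰`
(`t₂ = t₁` or `t₂ = τ(t₁)`), injectivity on each cell and the explicit preimages of a level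
`x > √D` (roots of `(1+x²)t² + (1−x²)t + 1`); the derivative `𝐰′ = (W/Dn²)/(2𝐰) ≠ 0` off `t⋆`;
THE RULE-2 WEIGHT IDENTITY `√3 (t + (1+√3)/2)(t − t⁴)^(−3/4)/|𝐰′| = √3(√3+1)(𝐰³ − D𝐰)^(−1/2)`
(registered sub-goal `stub_quotientWeight` of the item);
`ℚ`-semialgebraicity of `𝐰`, `𝐰′` and algebraicity of `√D` (`t⋆`: `isAlgebraic_tstar` of the stub-F file).
References: M. Kontsevich, D. Zagier, *Periods* (2001), §1.2 rule (2); J. Bochnak, M. Coste,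
M.-F. Roy, *Real Algebraic Geometry* (1998), §2.2.
-/
noncomputable section

open Set
open Literature.NumberTheory.Transcendental Literature.ModelTheory.ExponentialFields

namespace Summit.KontsevichZagierPeriods.TerasomaMultiplication.DasGapTwelve

/-! ### `√3`, `t⋆ = (√3 − 1)/2`, `D = 3 + 2√3` -/

/-- `(√3)² = 3`. [folklore] -/
theorem sqrt3_sq : Real.sqrt 3 ^ 2 = 3 := Real.sq_sqrt (by norm_num)

/-- `1 < √3`. [folklore] -/
theorem one_lt_sqrt3 : 1 < Real.sqrt 3 := by
  rw [show (1:ℝ) = Real.sqrt 1 by simp]; exact Real.sqrt_lt_sqrt (by norm_num) (by norm_num)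

/-- `√3 < 2`. [folklore] -/
theorem sqrt3_lt_two : Real.sqrt 3 < 2 := by
  rw [show (2:ℝ) = Real.sqrt 4 by rw [show (4:ℝ) = 2 ^ 2 by norm_num, Real.sqrt_sq two_pos.le]]
  exact Real.sqrt_lt_sqrt (by norm_num) (by norm_num)

/-- `0 < t⋆`. [folklore] -/
theorem tstar_pos : 0 < (Real.sqrt 3 - 1) / 2 := by linarith [one_lt_sqrt3]

/-- `t⋆ < 1`. [folklore] -/
theorem tstar_lt_one : (Real.sqrt 3 - 1) / 2 < 1 := by linarith [sqrt3_lt_two]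

/-- `t⋆` is the root of `2t² + 2t − 1` in `(0,1)`. [folklore] -/
theorem tstar_eq : 2 * ((Real.sqrt 3 - 1) / 2) ^ 2 + 2 * ((Real.sqrt 3 - 1) / 2) - 1 = 0 := by
  nlinarith [sqrt3_sq]

/-- `W(t) = 2t² + 2t − 1 = 2 (t − t⋆)(t + (1+√3)/2)`. [folklore] -/
theorem W_factor (t : ℝ) :
    2 * t ^ 2 + 2 * t - 1 = 2 * (t - (Real.sqrt 3 - 1) / 2) * (t + (1 + Real.sqrt 3) / 2) := by
  nlinarith [sqrt3_sq]

/-- `N − D·Dn = (1+√3)²(t − t⋆)²`: the level `D` of `𝐰²` is attained exactly at `t⋆`. [folklore] -/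
theorem N_sub_D_mul_Dn (t : ℝ) :
    (1 + t + t ^ 2) - (3 + 2 * Real.sqrt 3) * (t * (1 - t)) =
      ((1 + Real.sqrt 3) * (t - (Real.sqrt 3 - 1) / 2)) ^ 2 := by
  linear_combination (-t ^ 2 + (Real.sqrt 3 + 1) * t - (Real.sqrt 3 ^ 2 + 1) / 4) * sqrt3_sq

/-- `0 < D = 3 + 2√3`. [folklore] -/
theorem D_pos : 0 < 3 + 2 * Real.sqrt 3 := by positivity

/-- `t − t⁴ = N · Dn`. [folklore] -/
theorem P_eq (t : ℝ) : t - t ^ 4 = (1 + t + t ^ 2) * (t * (1 - t)) := by ring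

/-- On `(0,1)`: `N > 0`, `Dn > 0`, `N/Dn > 0`. [folklore] -/
theorem signs (t : ℝ) (ht : t ∈ Ioo (0:ℝ) 1) :
    0 < 1 + t + t ^ 2 ∧ 0 < t * (1 - t) ∧ 0 < (1 + t + t ^ 2) / (t * (1 - t)) := by
  have h1 : 0 < 1 + t + t ^ 2 := by nlinarith [ht.1]
  have h2 : 0 < t * (1 - t) := mul_pos ht.1 (by linarith [ht.2])
  exact ⟨h1, h2, div_pos h1 h2⟩

/-- `√D` is algebraic (root of `X⁴ − 6X² − 3`). [folklore] -/
theorem isAlgebraic_sqrtD : IsAlgebraic ℚ (Real.sqrt (3 + 2 * Real.sqrt 3)) := by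
  refine ⟨Polynomial.X ^ 4 - 6 * Polynomial.X ^ 2 - 3, ?_, ?_⟩
  · intro h
    have h0 := congrArg (Polynomial.eval 0) h
    norm_num at h0
  · simp only [map_sub, map_mul, map_pow, Polynomial.aeval_X, map_ofNat]
    have h2 : Real.sqrt (3 + 2 * Real.sqrt 3) ^ 2 = 3 + 2 * Real.sqrt 3 := Real.sq_sqrt D_pos.le
    have h4 : Real.sqrt (3 + 2 * Real.sqrt 3) ^ 4 = (3 + 2 * Real.sqrt 3) ^ 2 := by
      rw [show (4:ℕ) = 2 * 2 by norm_num, pow_mul, h2]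
    rw [h4, h2]
    nlinarith [sqrt3_sq]

/-! ### Levels and fibres of `𝐰` -/

/-- Off `t⋆`, `𝐰(t) > √D`. [folklore] -/
theorem sqrtD_lt_w (t : ℝ) (ht : t ∈ Ioo (0:ℝ) 1) (hne : t ≠ (Real.sqrt 3 - 1) / 2) :
    Real.sqrt (3 + 2 * Real.sqrt 3) < Real.sqrt ((1 + t + t ^ 2) / (t * (1 - t))) := by
  obtain ⟨_, hDn, _⟩ := signs t ht
  apply Real.sqrt_lt_sqrt D_pos.le
  rw [lt_div_iff₀ hDn, ← sub_pos, N_sub_D_mul_Dn]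
  have : (1 + Real.sqrt 3) * (t - (Real.sqrt 3 - 1) / 2) ≠ 0 :=
    mul_ne_zero (by positivity) (sub_ne_zero.mpr hne)
  positivity

/-- The fibres of `𝐰` on `(0,1)`: `𝐰(t₁) = 𝐰(t₂)` forces `t₁ = t₂` or
`1 − t₁ − t₂ − 2 t₁ t₂ = 0` (i.e. `t₂ = τ(t₁) = (1 − t₁)/(1 + 2t₁)`). [folklore] -/
theorem w_eq_w (t₁ t₂ : ℝ) (h₁ : t₁ ∈ Ioo (0:ℝ) 1) (h₂ : t₂ ∈ Ioo (0:ℝ) 1)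
    (h : Real.sqrt ((1 + t₁ + t₁ ^ 2) / (t₁ * (1 - t₁))) =
      Real.sqrt ((1 + t₂ + t₂ ^ 2) / (t₂ * (1 - t₂)))) :
    t₁ = t₂ ∨ 1 - t₁ - t₂ - 2 * t₁ * t₂ = 0 := by
  obtain ⟨_, hD₁, hρ₁⟩ := signs t₁ h₁
  obtain ⟨_, hD₂, hρ₂⟩ := signs t₂ h₂
  have h' : (1 + t₁ + t₁ ^ 2) / (t₁ * (1 - t₁)) = (1 + t₂ + t₂ ^ 2) / (t₂ * (1 - t₂)) := by
    have := congrArg (fun y => y ^ 2) h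
    simpa only [Real.sq_sqrt hρ₁.le, Real.sq_sqrt hρ₂.le] using this
  rw [div_eq_div_iff hD₁.ne' hD₂.ne'] at h'
  have key : (t₂ - t₁) * (1 - t₁ - t₂ - 2 * t₁ * t₂) = 0 := by linear_combination h'
  rcases mul_eq_zero.mp key with h0 | h0
  exacts [Or.inl (by linarith), Or.inr h0]

/-- `𝐰` is injective on the left cell `(0, t⋆)`. [folklore] -/
theorem w_injOn_left : InjOn (fun t : ℝ => Real.sqrt ((1 + t + t ^ 2) / (t * (1 - t))))
    (Ioo (0:ℝ) ((Real.sqrt 3 - 1) / 2)) := by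
  intro t₁ h₁ t₂ h₂ h
  have h₁' : t₁ ∈ Ioo (0:ℝ) 1 := ⟨h₁.1, h₁.2.trans tstar_lt_one⟩
  have h₂' : t₂ ∈ Ioo (0:ℝ) 1 := ⟨h₂.1, h₂.2.trans tstar_lt_one⟩
  rcases w_eq_w t₁ t₂ h₁' h₂' h with h0 | h0
  · exact h0
  · exfalso
    nlinarith [tstar_eq, h₁.1, h₁.2, h₂.1, h₂.2, mul_pos h₁.1 h₂.1]

/-- `𝐰` is injective on the right cell `(t⋆, 1)`. [folklore] -/
theorem w_injOn_right : InjOn (fun t : ℝ => Real.sqrt ((1 + t + t ^ 2) / (t * (1 - t))))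
    (Ioo ((Real.sqrt 3 - 1) / 2) (1:ℝ)) := by
  intro t₁ h₁ t₂ h₂ h
  have h₁' : t₁ ∈ Ioo (0:ℝ) 1 := ⟨tstar_pos.trans h₁.1, h₁.2⟩
  have h₂' : t₂ ∈ Ioo (0:ℝ) 1 := ⟨tstar_pos.trans h₂.1, h₂.2⟩
  rcases w_eq_w t₁ t₂ h₁' h₂' h with h0 | h0
  · exact h0
  · exfalso
    nlinarith [tstar_eq, h₁.1, h₁.2, h₂.1, h₂.2, tstar_pos,
      mul_pos (sub_pos.mpr h₁.1) (sub_pos.mpr h₂.1)]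

/-- The two preimages of a level `x > √D`: the roots `t₁ < t₂` of `(1+x²)t² + (1−x²)t + 1 = 0`
lie in `(0, t⋆)` and `(t⋆, 1)` respectively, and `𝐰(t₁) = 𝐰(t₂) = x`. [folklore] -/
theorem exists_preimages (x : ℝ) (hx : Real.sqrt (3 + 2 * Real.sqrt 3) < x) :
    ∃ t₁ t₂ : ℝ, t₁ ∈ Ioo (0:ℝ) ((Real.sqrt 3 - 1) / 2) ∧ t₂ ∈ Ioo ((Real.sqrt 3 - 1) / 2) (1:ℝ) ∧
      Real.sqrt ((1 + t₁ + t₁ ^ 2) / (t₁ * (1 - t₁))) = x ∧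
      Real.sqrt ((1 + t₂ + t₂ ^ 2) / (t₂ * (1 - t₂))) = x := by
  have hx0 : 0 < x := (Real.sqrt_pos.mpr D_pos).trans hx
  have hxD : 3 + 2 * Real.sqrt 3 < x ^ 2 := by
    have := Real.sq_sqrt D_pos.le
    nlinarith [Real.sqrt_nonneg (3 + 2 * Real.sqrt 3)]
  -- discriminant `Δ = (1−x²)² − 4(1+x²) = (x²−3)² − 12 > 0`
  set Δ : ℝ := (1 - x ^ 2) ^ 2 - 4 * (1 + x ^ 2) with hΔ_def
  have hΔ : 0 < Δ := by
    have h3 : 2 * Real.sqrt 3 < x ^ 2 - 3 := by linarith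
    have : (2 * Real.sqrt 3) ^ 2 < (x ^ 2 - 3) ^ 2 := by
      exact pow_lt_pow_left₀ h3 (by positivity) two_ne_zero
    nlinarith [sqrt3_sq]
  set s : ℝ := Real.sqrt Δ with hs_def
  have hs0 : 0 < s := Real.sqrt_pos.mpr hΔ
  have hss : s * s = Δ := Real.mul_self_sqrt hΔ.le
  have ha : (1 + x ^ 2) ≠ 0 := by positivity
  set t₁ : ℝ := (-(1 - x ^ 2) - s) / (2 * (1 + x ^ 2)) with ht₁_def
  set t₂ : ℝ := (-(1 - x ^ 2) + s) / (2 * (1 + x ^ 2)) with ht₂_def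
  -- the quadratic `(1+x²)t² + (1−x²)t + 1` vanishes at `t₁`, `t₂`
  have hq₁ : (1 + x ^ 2) * t₁ ^ 2 + (1 - x ^ 2) * t₁ + 1 = 0 := by
    rw [ht₁_def]
    field_simp
    linear_combination hss
  have hq₂ : (1 + x ^ 2) * t₂ ^ 2 + (1 - x ^ 2) * t₂ + 1 = 0 := by
    rw [ht₂_def]
    field_simp
    linear_combination hss
  -- Vieta
  have hsum : t₁ + t₂ = (x ^ 2 - 1) / (1 + x ^ 2) := by
    rw [ht₁_def, ht₂_def]; field_simp; ring
  have hprod : t₁ * t₂ = 1 / (1 + x ^ 2) := by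
    rw [ht₁_def, ht₂_def]; field_simp; linear_combination -hss
  have hlt : t₁ < t₂ := by
    rw [ht₁_def, ht₂_def]
    apply div_lt_div_of_pos_right _ (by positivity)
    linarith
  -- location of the roots: both positive
  have hprod_pos : 0 < t₁ * t₂ := by rw [hprod]; positivity
  have hsum_pos : 0 < t₁ + t₂ := by
    rw [hsum]; apply div_pos _ (by positivity); nlinarith [D_pos]
  have ht₁0 : 0 < t₁ := by
    rcases le_or_gt t₁ 0 with h | h
    · nlinarith
    · exact h
  -- `(t₁ − t⋆)(t₂ − t⋆) = Dn(t⋆)(D − x²)/(1+x²) < 0`, so `t₁ < t⋆ < t₂`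
  have hN : 1 + (Real.sqrt 3 - 1) / 2 + ((Real.sqrt 3 - 1) / 2) ^ 2 =
      (3 + 2 * Real.sqrt 3) * ((Real.sqrt 3 - 1) / 2 * (1 - (Real.sqrt 3 - 1) / 2)) := by
    have h := N_sub_D_mul_Dn ((Real.sqrt 3 - 1) / 2)
    rw [sub_self, mul_zero, zero_pow two_ne_zero, sub_eq_zero] at h
    exact h
  have hstar : (t₁ - (Real.sqrt 3 - 1) / 2) * (t₂ - (Real.sqrt 3 - 1) / 2) < 0 := by
    have e1 : (t₁ - (Real.sqrt 3 - 1) / 2) * (t₂ - (Real.sqrt 3 - 1) / 2) =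
        (1 - (Real.sqrt 3 - 1) / 2 * (x ^ 2 - 1) + ((Real.sqrt 3 - 1) / 2) ^ 2 * (1 + x ^ 2)) /
          (1 + x ^ 2) := by
      rw [show (t₁ - (Real.sqrt 3 - 1) / 2) * (t₂ - (Real.sqrt 3 - 1) / 2) =
        t₁ * t₂ - (Real.sqrt 3 - 1) / 2 * (t₁ + t₂) + ((Real.sqrt 3 - 1) / 2) ^ 2 by ring,
        hprod, hsum]
      field_simp
    have e2 : 1 - (Real.sqrt 3 - 1) / 2 * (x ^ 2 - 1) + ((Real.sqrt 3 - 1) / 2) ^ 2 * (1 + x ^ 2) =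
        ((Real.sqrt 3 - 1) / 2 * (1 - (Real.sqrt 3 - 1) / 2)) * ((3 + 2 * Real.sqrt 3) - x ^ 2) := by
      linear_combination hN
    rw [e1, e2]
    exact div_neg_of_neg_of_pos (mul_neg_of_pos_of_neg
      (mul_pos tstar_pos (by linarith [tstar_lt_one])) (by linarith)) (by positivity)
  have ht₁s : t₁ < (Real.sqrt 3 - 1) / 2 := by
    rcases lt_or_ge t₁ ((Real.sqrt 3 - 1) / 2) with h | h
    · exact h
    · have h2 : 0 ≤ t₂ - (Real.sqrt 3 - 1) / 2 := by linarith
      have := mul_nonneg (sub_nonneg.mpr h) h2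
      linarith
  have ht₂s : (Real.sqrt 3 - 1) / 2 < t₂ := by
    have h1 : t₁ - (Real.sqrt 3 - 1) / 2 < 0 := by linarith
    rcases lt_or_ge ((Real.sqrt 3 - 1) / 2) t₂ with h | h
    · exact h
    · have := mul_nonneg_of_nonpos_of_nonpos h1.le (sub_nonpos.mpr h)
      linarith
  have ht₂1 : t₂ < 1 := by
    have e : (1 - t₁) * (1 - t₂) = 3 / (1 + x ^ 2) := by
      rw [show (1 - t₁) * (1 - t₂) = 1 - (t₁ + t₂) + t₁ * t₂ by ring, hsum, hprod]
      field_simp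
      ring
    have hpos : 0 < (1 - t₁) * (1 - t₂) := by rw [e]; positivity
    have h1 : 0 < 1 - t₁ := by linarith [tstar_lt_one]
    rcases lt_or_ge t₂ 1 with h | h
    · exact h
    · have := mul_nonpos_of_nonneg_of_nonpos h1.le (sub_nonpos.mpr h)
      linarith
  -- the level of `𝐰` at a root is `x`
  have hlev : ∀ t, 0 < t → t < 1 → (1 + x ^ 2) * t ^ 2 + (1 - x ^ 2) * t + 1 = 0 →
      Real.sqrt ((1 + t + t ^ 2) / (t * (1 - t))) = x := by
    intro t h0 h1 hq
    have hDn : t * (1 - t) ≠ 0 := (mul_pos h0 (by linarith)).ne'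
    rw [show 1 + t + t ^ 2 = x ^ 2 * (t * (1 - t)) by linear_combination hq, mul_div_assoc,
      div_self hDn, mul_one, Real.sqrt_sq hx0.le]
  exact ⟨t₁, t₂, ⟨ht₁0, ht₁s⟩, ⟨ht₂s, ht₂1⟩, hlev t₁ ht₁0 (ht₁s.trans tstar_lt_one) hq₁,
    hlev t₂ (tstar_pos.trans ht₂s) ht₂1 hq₂⟩


/-! ### The derivative of `𝐰` -/

/-- `(N/Dn)′ = W/Dn²` on `Dn ≠ 0`. [folklore] -/
theorem hasDerivAt_ratio (t : ℝ) (hDn : t * (1 - t) ≠ 0) :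
    HasDerivAt (fun y : ℝ => (1 + y + y ^ 2) / (y * (1 - y)))
      ((2 * t ^ 2 + 2 * t - 1) / (t * (1 - t)) ^ 2) t := by
  have hN : HasDerivAt (fun y : ℝ => 1 + y + y ^ 2) (0 + 1 + (2:ℕ) * t ^ (2 - 1)) t :=
    ((hasDerivAt_const t 1).add (hasDerivAt_id t)).add (hasDerivAt_pow 2 t)
  have hD : HasDerivAt (fun y : ℝ => y * (1 - y)) (1 * (1 - t) + t * (0 - 1)) t :=
    (hasDerivAt_id t).mul ((hasDerivAt_const t 1).sub (hasDerivAt_id t))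
  refine (hN.div hD hDn).congr_deriv ?_
  push_cast
  ring

/-- `𝐰′ = (W/Dn²)/(2𝐰)` on `(0,1)`. [folklore] -/
theorem hasDerivAt_w (t : ℝ) (ht : t ∈ Ioo (0:ℝ) 1) :
    HasDerivAt (fun y : ℝ => Real.sqrt ((1 + y + y ^ 2) / (y * (1 - y))))
      ((2 * t ^ 2 + 2 * t - 1) / (t * (1 - t)) ^ 2 /
        (2 * Real.sqrt ((1 + t + t ^ 2) / (t * (1 - t))))) t := by
  obtain ⟨_, hDn, hρ⟩ := signs t ht
  exact (hasDerivAt_ratio t hDn.ne').sqrt hρ.ne'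

/-- `𝐰′ ≠ 0` off `t⋆`. [folklore] -/
theorem w'_ne_zero (t : ℝ) (ht : t ∈ Ioo (0:ℝ) 1) (hne : t ≠ (Real.sqrt 3 - 1) / 2) :
    (2 * t ^ 2 + 2 * t - 1) / (t * (1 - t)) ^ 2 /
        (2 * Real.sqrt ((1 + t + t ^ 2) / (t * (1 - t)))) ≠ 0 := by
  obtain ⟨_, hDn, hρ⟩ := signs t ht
  have hW : 2 * t ^ 2 + 2 * t - 1 ≠ 0 := by
    rw [W_factor]
    exact mul_ne_zero (mul_ne_zero two_ne_zero (sub_ne_zero.mpr hne))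
      (by linarith [ht.1, one_lt_sqrt3] : t + (1 + Real.sqrt 3) / 2 ≠ 0)
  exact div_ne_zero (div_ne_zero hW (pow_ne_zero 2 hDn.ne'))
    (mul_ne_zero two_ne_zero (Real.sqrt_pos.mpr hρ).ne')

/-! ### The rule-2 weight identity -/

/-- **The weight identity of the quotient step.** For `t ∈ (0,1)`, `t ≠ t⋆`, with
`x = 𝐰(t)`: `√3 (t + (1+√3)/2) (t − t⁴)^(−3/4) / |𝐰′(t)| = √3 (√3+1) (x³ − D x)^(−1/2)`.
(With `u = (t − t⁴)^(1/4)`: `(t−t⁴)^(−3/4) = u⁻³`, `𝐰 = u²/Dn`, `𝐰³ − D𝐰 = (u(1+√3)(t−t⋆)/Dn)²`,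
`|W| = 2|t − t⋆|(t + (1+√3)/2)`; both sides equal `√3·Dn/(u |t − t⋆|)`.) [folklore] -/
theorem stub_quotientWeight :
    ∀ (t : ℝ), t ∈ Set.Ioo (0:ℝ) 1 → t ≠ (Real.sqrt 3 - 1) / 2 → Real.sqrt 3 * (t + (1 + Real.sqrt 3) / 2) * (t - t ^ 4) ^ (-(3:ℝ)/4) / |(2 * t ^ 2 + 2 * t - 1) / (t * (1 - t)) ^ 2 / (2 * Real.sqrt ((1 + t + t ^ 2) / (t * (1 - t))))| = Real.sqrt 3 * (Real.sqrt 3 + 1) * (Real.sqrt ((1 + t + t ^ 2) / (t * (1 - t))) ^ 3 - (3 + 2 * Real.sqrt 3) * Real.sqrt ((1 + t + t ^ 2) / (t * (1 - t)))) ^ (-(1:ℝ)/2) := by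
  intro t ht hne
  obtain ⟨hN, hDn, hρ⟩ := signs t ht
  have hc : 0 < t + (1 + Real.sqrt 3) / 2 := by linarith [ht.1, one_lt_sqrt3]
  have h13 : 0 < 1 + Real.sqrt 3 := by positivity
  have hts : t - (Real.sqrt 3 - 1) / 2 ≠ 0 := sub_ne_zero.mpr hne
  set w : ℝ := Real.sqrt ((1 + t + t ^ 2) / (t * (1 - t))) with hw
  have hw0 : 0 < w := Real.sqrt_pos.mpr hρ
  have hP : 0 < t - t ^ 4 := by rw [P_eq]; exact mul_pos hN hDn
  set u : ℝ := (t - t ^ 4) ^ ((4:ℝ)⁻¹) with hu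
  have hu0 : 0 < u := Real.rpow_pos_of_pos hP _
  have hu4 : u ^ 4 = (1 + t + t ^ 2) * (t * (1 - t)) := by
    rw [hu, ← Real.rpow_natCast, ← Real.rpow_mul hP.le, ← P_eq]
    norm_num
  -- (1) `(t − t⁴)^(−3/4) = u⁻³`
  have e1 : (t - t ^ 4) ^ (-(3:ℝ)/4) = (u ^ 3)⁻¹ := by
    rw [show (-(3:ℝ)/4) = (4:ℝ)⁻¹ * (-(3:ℝ)) by norm_num, Real.rpow_mul hP.le, ← hu,
      Real.rpow_neg hu0.le, show (3:ℝ) = ((3:ℕ):ℝ) by norm_num, Real.rpow_natCast]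
  -- (2) `𝐰 = u²/Dn`
  have hDn0 : t * (1 - t) ≠ 0 := hDn.ne'
  have e2 : w = u ^ 2 / (t * (1 - t)) := by
    rw [hw, Real.sqrt_eq_iff_mul_self_eq_of_pos (by positivity)]
    rw [show u ^ 2 / (t * (1 - t)) * (u ^ 2 / (t * (1 - t))) =
      u ^ 4 / (t * (1 - t)) / (t * (1 - t)) by ring, hu4, mul_div_assoc, div_self hDn0, mul_one]
  -- (3) `𝐰³ − D𝐰 = (u(1+√3)(t−t⋆)/Dn)²`
  have e3 : w ^ 3 - (3 + 2 * Real.sqrt 3) * w =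
      (u * (1 + Real.sqrt 3) * (t - (Real.sqrt 3 - 1) / 2) / (t * (1 - t))) ^ 2 := by
    have hw2 : w ^ 2 = (1 + t + t ^ 2) / (t * (1 - t)) := by rw [hw, Real.sq_sqrt hρ.le]
    have hsq := N_sub_D_mul_Dn t
    calc w ^ 3 - (3 + 2 * Real.sqrt 3) * w = w * (w ^ 2 - (3 + 2 * Real.sqrt 3)) := by ring
      _ = u ^ 2 / (t * (1 - t)) *
          (((1 + t + t ^ 2) - (3 + 2 * Real.sqrt 3) * (t * (1 - t))) / (t * (1 - t))) := by
          rw [hw2, e2, sub_div, mul_div_cancel_right₀ _ hDn0]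
      _ = (u * (1 + Real.sqrt 3) * (t - (Real.sqrt 3 - 1) / 2) / (t * (1 - t))) ^ 2 := by
          rw [hsq]
          field_simp
  -- (4) `(𝐰³ − D𝐰)^(−1/2) = (u(1+√3)|t−t⋆|/Dn)⁻¹`
  have e4 : (w ^ 3 - (3 + 2 * Real.sqrt 3) * w) ^ (-(1:ℝ)/2) =
      (u * (1 + Real.sqrt 3) * |t - (Real.sqrt 3 - 1) / 2| / (t * (1 - t)))⁻¹ := by
    have hnn : 0 ≤ w ^ 3 - (3 + 2 * Real.sqrt 3) * w := by rw [e3]; positivity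
    rw [show (-(1:ℝ)/2) = -((1:ℝ)/2) by norm_num, Real.rpow_neg hnn, ← Real.sqrt_eq_rpow, e3,
      Real.sqrt_sq_eq_abs, abs_div, abs_mul, abs_mul, abs_of_pos hu0, abs_of_pos h13,
      abs_of_pos hDn]
  -- (5) `|𝐰′| = 2|t − t⋆|(t + (1+√3)/2)/(Dn² · 2𝐰)`
  have e5 : |(2 * t ^ 2 + 2 * t - 1) / (t * (1 - t)) ^ 2 / (2 * w)| =
      2 * |t - (Real.sqrt 3 - 1) / 2| * (t + (1 + Real.sqrt 3) / 2) /
        (t * (1 - t)) ^ 2 / (2 * w) := by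
    rw [abs_div, abs_div, abs_of_pos (pow_pos hDn 2), abs_of_pos (by positivity : 0 < 2 * w),
      W_factor, abs_mul, abs_mul, abs_two, abs_of_pos hc]
  -- assemble
  have habs : 0 < |t - (Real.sqrt 3 - 1) / 2| := abs_pos.mpr hts
  rw [e1, e4, e5, e2]
  set A : ℝ := |t - (Real.sqrt 3 - 1) / 2| with hA
  set C : ℝ := t + (1 + Real.sqrt 3) / 2 with hC
  set Dn : ℝ := t * (1 - t) with hDn_def
  have hA0 : A ≠ 0 := habs.ne'
  have hC0 : C ≠ 0 := hc.ne'
  have hu0' : u ≠ 0 := hu0.ne'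
  have h13' : 1 + Real.sqrt 3 ≠ 0 := h13.ne'
  have h31' : Real.sqrt 3 + 1 ≠ 0 := by rw [add_comm]; exact h13.ne'
  field_simp
  ring

/-! ### Semialgebraicity of `𝐰`, `𝐰′` -/

/-- `p ↦ 𝐰(p 0)` is `ℚ`-semialgebraic on any `ℚ`-semialgebraic `σ ⊆ ℝ¹` where `Dn ≠ 0`.
[cite: BochnakCosteRoy1998, §2.2] -/
theorem w_semialgebraic {σ : Set (Fin 1 → ℝ)} (hσ : IsSemialgebraic ℚ σ)
    (hD : ∀ p ∈ σ, p 0 * (1 - p 0) ≠ 0) :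
    IsSemialgebraicFunOn ℚ σ
      (fun p => Real.sqrt ((1 + p 0 + (p 0) ^ 2) / (p 0 * (1 - p 0)))) := by
  have h1 := isSemialgebraicFunOn_aeval_div_aeval hσ
    (1 + MvPolynomial.X 0 + MvPolynomial.X 0 ^ 2 : MvPolynomial (Fin 1) ℚ)
    (MvPolynomial.X 0 * (1 - MvPolynomial.X 0)) (fun p hp => by simpa using hD p hp)
  have h2 : IsSemialgebraicFunOn ℚ σ (fun p => (1 + p 0 + (p 0) ^ 2) / (p 0 * (1 - p 0))) :=
    h1.congr (fun p _ => by simp)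
  exact IsSemialgebraicFunOn.sqrt_holds h2

/-- `p ↦ 𝐰′(p 0)` is `ℚ`-semialgebraic on any `ℚ`-semialgebraic `σ ⊆ ℝ¹` where `Dn ≠ 0`,
`N/Dn > 0`. [cite: BochnakCosteRoy1998, Prop. 2.2.6] -/
theorem w'_semialgebraic {σ : Set (Fin 1 → ℝ)} (hσ : IsSemialgebraic ℚ σ)
    (hD : ∀ p ∈ σ, p 0 * (1 - p 0) ≠ 0)
    (hρ : ∀ p ∈ σ, 0 < (1 + p 0 + (p 0) ^ 2) / (p 0 * (1 - p 0))) :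
    IsSemialgebraicFunOn ℚ σ
      (fun p => (2 * (p 0) ^ 2 + 2 * p 0 - 1) / (p 0 * (1 - p 0)) ^ 2 /
        (2 * Real.sqrt ((1 + p 0 + (p 0) ^ 2) / (p 0 * (1 - p 0))))) := by
  have h1 := isSemialgebraicFunOn_aeval_div_aeval hσ
    (2 * MvPolynomial.X 0 ^ 2 + 2 * MvPolynomial.X 0 - 1 : MvPolynomial (Fin 1) ℚ)
    ((MvPolynomial.X 0 * (1 - MvPolynomial.X 0)) ^ 2)
    (fun p hp => by simpa using pow_ne_zero 2 (hD p hp))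
  have h2 : IsSemialgebraicFunOn ℚ σ
      (fun p => (2 * (p 0) ^ 2 + 2 * p 0 - 1) / (p 0 * (1 - p 0)) ^ 2) :=
    h1.congr (fun p _ => by simp)
  have h3 : IsSemialgebraicFunOn ℚ σ
      (fun p => 2 * Real.sqrt ((1 + p 0 + (p 0) ^ 2) / (p 0 * (1 - p 0)))) :=
    (isSemialgebraicFunOn_const_ofNat hσ 2).fun_mul (w_semialgebraic hσ hD)
  exact h2.div h3 fun p hp => mul_ne_zero two_ne_zero (Real.sqrt_pos.mpr (hρ p hp)).ne'
end Summit.KontsevichZagierPeriods.TerasomaMultiplication.DasGapTwelve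

end
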